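import Literature.NumberTheory.GaloisCohomology.Howard2004.SelmerTriples
import Literature.NumberTheory.GaloisCohomology.PairingTateDual
import Literature.NumberTheory.GaloisRepresentations.ContinuousCupProductCompat
import Literature.NumberTheory.EllipticCurves.ZpExtensionEisensteinSelmerStructure
import HarnessLib

/-!
# From Howard's `R(1)`-valued duality datum to Tate duality: `Tw(T) → T^∨(1)` and
# `(exp ∘ λ)_* (x ∪_e y) = ⟨x, Θ_* y⟩_{Tate}` for the induced local pairing of H.4

Topic `NumberTheory/GaloisCohomology/Howard2004` (sequel to `SelmerTriples` §H4; definitions with bodies + theorems;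
no named fact, no instance, no notation, no `sorry`).

Howard 2004, §1.3 H.4 carries an `R`-bilinear `e : T × T → R(1)` with `(s^σ, t^{τστ⁻¹}) = (s, t)^σ` and asks that the
local condition be its own exact orthogonal complement under the INDUCED local pairing
`H¹(K_v, T) × H¹(K_v, Tw T) → H²(K_v, R(1))` (the cell's `DualityDatum.localCup`). The tree's duality theorems (local
Tate duality `localTatePairing(ZMod)`, `LocalInvariants.IsPerfect/UnramifiedOrthogonal`, Poitou–Tate) are stated for
the EVALUATION pairing `T × T^∨(1) → μₙ`, `T^∨(1) = tateDual`. This file is the bridge, for a datum `D` over a level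
ring `R` at level `n = p^k` read through

* a CHARACTER `λ : R → ℤ/p^k` with `λ(algebraMap ℤ_[p] R z · r) = (z mod p^k) λ(r)` (for `R = A_{m,k}` the tail form
  `EisensteinCoeff.tailFormZMod`, cell file `ZpExtensionEisensteinTwistDualityForm.tailFormZMod_ofZMod_mul` with
  `algebraMap_padicInt_eq_ofZMod_toZModPow`), and
* a TRIVIALISATION `exp : ℤ/p^k → μ_{p^k}` with `exp(χ̄(g) x) = g · exp(x)` (a primitive `p^k`-th root of unity,
  `GaloisRep.cyclotomicCharacter_spec`):

* §1 `D.expLam λ exp : R →+ μ_{p^k}` is `Γ_K`-equivariant from `R(1)` (`expLam_twistOne`); the `μ`-valued pairing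
  `D.muPairing λ exp : T × T → μ_{p^k}`, `(s, t) ↦ exp λ e(s, t)`, equivariant for `(ρ, Tw ρ)` (`muPairing_equivariant`);
  hence **`D.toTateDual λ exp : Tw(T) →ⁱL T^∨(1)`** (tree `pairingDualIntertwining`), `toTateDual_apply_apply`.
* §2 the local bridge **`cohomologyMap_localCup_eq_localTatePairing`**: at every place `v`,
  `H²(exp ∘ λ) (D.localCup v x y) = localTatePairing ρ (p^k) v x (H¹(Θ_v) y)`, `Θ_v` the localisation of `toTateDual`
  (tree `cupProduct_map` + `cupProduct_adjoint`); so ISOTROPY for `localCup` implies isotropy for the Tate pairing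
  (`localTatePairing_eq_zero_of_localCup_eq_zero`), and orthogonal complements computed with `localTatePairingZMod`
  after `Θ` contain those of `localCup` — the form in which `LocalInvariants.UnramifiedOrthogonal` and
  `PairingExactAnnihilatorProofs` are applied to H.4's local clause.

Injectivity/bijectivity of `toTateDual` (from `D.perfect` + `λ` Frobenius + `exp` bijective) and of `H²(exp ∘ λ)` on
`R`-submodules are NOT asserted here (for the Eisenstein levels: `eisensteinTwistDualMap_bijective` /
`homEquivZMod`). BSD is not proved by any of this.

References: [Howard2004HeegnerKolyvagin] B. Howard, Compositio Math. 140 (2004), §1.3 H.4 (arXiv p. 7 L69–90), §2.1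
(`Hom_{S_𝔭}(N, 𝒟_𝔭(1)) ≅ Hom_{ℤ_p}(N, μ_{p^∞})`); [MilneADT2006] I §0, Cor. 2.3; [NeukirchSchmidtWingberg2008] I §4 (1.4.2).
-/

noncomputable section

open CategoryTheory Function NumberField Field
open scoped ContRepresentation

namespace Literature.NumberTheory.GaloisCohomology.Howard2004

open Literature.NumberTheory.GaloisRepresentations
open Literature.NumberTheory.GaloisRepresentations.DiscreteGaloisModule

attribute [local instance] absoluteGaloisGroup_compactSpace

variable {K : Type} [Field K] [NumberField K] {M : Type} [AddCommGroup M] [TopologicalSpace M]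
  [DiscreteTopology M] {R : Type} [CommRing R] [Module R M] [TopologicalSpace R] [DiscreteTopology R]
  {p : ℕ} [Fact p.Prime] [Algebra ℤ_[p] R] {cd : ConjugationDatum K} {ρ : DiscreteGaloisModule K M}
  (D : DualityDatum p cd ρ R) {k : ℕ}
  (lam : R →+ ZMod (p ^ k))
  (hlam : ∀ (z : ℤ_[p]) (r : R), lam (algebraMap ℤ_[p] R z * r) = PadicInt.toZModPow k z * lam r)
  (exp : ZMod (p ^ k) →+ MuCarrier K (p ^ k))
  (hexp : ∀ (g : absoluteGaloisGroup K) (x : ZMod (p ^ k)),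
    exp (cyclotomicCharacterModPow K p k g * x) = mu K (p ^ k) g (exp x))

namespace DualityDatum

/-! ## §1 `R(1) → μ_{p^k}`, the `μ`-valued pairing, and `Tw(T) → T^∨(1)` -/

/-- The character `exp ∘ λ : R(1) → μ_{p^k}`. [cite: Howard2004HeegnerKolyvagin, §2.1 (𝒟_𝔭(1) → μ_{p^∞})] -/
def expLam (_D : DualityDatum p cd ρ R) (lam : R →+ ZMod (p ^ k)) (exp : ZMod (p ^ k) →+ MuCarrier K (p ^ k)) :
    R →+ MuCarrier K (p ^ k) :=
  exp.comp lam

/-- Unfolding: `expLam r = exp (λ r)`. [cite: Howard2004HeegnerKolyvagin, §2.1] -/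
@[simp]
theorem expLam_apply (r : R) : D.expLam lam exp r = exp (lam r) := rfl

include hlam hexp in
/-- **`exp ∘ λ` is `Γ_K`-equivariant `R(1) → μ_{p^k}`**: `exp λ (g · r) = g · exp λ(r)` (`g · r = χ(g) r` by `twistOne_apply`).
[cite: Howard2004HeegnerKolyvagin, §1.3 (H.4: R(1)) and §2.1] -/
theorem expLam_twistOne (g : absoluteGaloisGroup K) (r : R) :
    D.expLam lam exp (D.twistOne g r) = mu K (p ^ k) g (D.expLam lam exp r) := by
  rw [expLam_apply, expLam_apply, D.twistOne_apply, hlam, ← cyclotomicCharacterModPow_apply, hexp]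

/-- The `μ_{p^k}`-valued pairing `(s, t) ↦ exp λ e(s, t)` on `T × T`. [cite: Howard2004HeegnerKolyvagin, §1.3 (H.4) and §2.1] -/
def muPairing : M →+ M →+ MuCarrier K (p ^ k) :=
  D.eHom.compr₂ (D.expLam lam exp)

/-- Unfolding: `muPairing s t = exp (λ (e s t))`. [cite: Howard2004HeegnerKolyvagin, §1.3 (H.4)] -/
@[simp]
theorem muPairing_apply (s t : M) : D.muPairing lam exp s t = exp (lam (D.e s t)) := rfl

include hlam hexp in
/-- **Equivariance** of the `μ`-valued pairing for the pair `(T, Tw T)`: `⟨g s, (τgτ⁻¹) t⟩ = g · ⟨s, t⟩`.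
[cite: Howard2004HeegnerKolyvagin, §1.3 (H.4: (s^σ, t^{τστ⁻¹}) = (s,t)^σ)] -/
theorem muPairing_equivariant (g : absoluteGaloisGroup K) (s t : M) :
    D.muPairing lam exp (ρ g s) (cd.twist ρ g t) = mu K (p ^ k) g (D.muPairing lam exp s t) := by
  have h := D.eHom_equivariant g s t
  change D.e (ρ g s) (cd.twist ρ g t) = D.twistOne g (D.e s t) at h
  rw [muPairing_apply, muPairing_apply, h, ← expLam_apply D lam exp, expLam_twistOne D lam hlam exp hexp, expLam_apply]

/-- **`Θ : Tw(T) →ⁱL T^∨(1) = Hom(T, μ_{p^k})`, `t ↦ (s ↦ exp λ e(s, t))`** — the `R(1)`-valued self-duality of H.4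
read as a map to the Tate dual (tree `pairingDualIntertwining`). [cite: Howard2004HeegnerKolyvagin, §1.3 (H.4) and §2.1] -/
def toTateDual [Finite M] : (cd.twist ρ).toContRepresentation →ⁱL (ρ.tateDual (p ^ k)).toContRepresentation :=
  DiscreteGaloisModule.pairingDualIntertwining (ρ₁ := ρ) (ρ₂ := cd.twist ρ) (n := p ^ k) (B := D.muPairing lam exp)
    (D.muPairing_equivariant lam hlam exp hexp)

/-- Unfolding: `Θ t s = exp (λ (e s t))`. [cite: Howard2004HeegnerKolyvagin, §1.3 (H.4)] -/
@[simp]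
theorem toTateDual_apply_apply [Finite M] (t s : M) : D.toTateDual lam hlam exp hexp t s = exp (lam (D.e s t)) := rfl

/-! ## §2 The local bridge: `H²(exp ∘ λ) ∘ localCup = localTatePairing ∘ (id × H¹(Θ))` -/

/-- `exp ∘ λ` on the local modules at a place `v`, as a morphism `R(1)|_{Γ_{K_v}} ⟶ μ_{p^k}|_{Γ_{K_v}}` of topological
representations. [cite: Howard2004HeegnerKolyvagin, §1.3 (H.4: the induced local pairing)] -/
def expLamLocalHom (v : Place K) : (D.twistOne.toLocal v).toTopRep ⟶ ((mu K (p ^ k)).toLocal v).toTopRep :=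
  TopRep.ofHom
    { toContinuousLinearMap := ⟨(D.expLam lam exp).toIntLinearMap, continuous_of_discreteTopology⟩
      isIntertwining' := fun σ => ContinuousLinearMap.ext fun r =>
        D.expLam_twistOne lam hlam exp hexp (absGaloisRestrict K (Place.Completion v) σ) r }

/-- The `μ`-valued pairing of the LOCAL modules `T|_v × Tw(T)|_v → μ_{p^k}|_v`. [cite: Howard2004HeegnerKolyvagin, §1.3 (H.4)] -/
def muPairingLocal (v : Place K) :
    ContPairing (ρ.toLocal v).toTopRep ((cd.twist ρ).toLocal v).toTopRep ((mu K (p ^ k)).toLocal v).toTopRep :=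
  DiscreteGaloisModule.pairing (ρ.toLocal v) ((cd.twist ρ).toLocal v) ((mu K (p ^ k)).toLocal v) (D.muPairing lam exp)
    fun _ s t => D.muPairing_equivariant lam hlam exp hexp _ s t

/-- **The bridge at a place `v`**: pushing the induced local pairing of H.4 along `exp ∘ λ : R(1) → μ_{p^k}` gives the
local Tate (evaluation) pairing against `Θ_* y`:
`H²(exp ∘ λ)(x ∪_e y) = localTatePairing ρ (p^k) v x (H¹(Θ_v) y)`. [cite: Howard2004HeegnerKolyvagin, §1.3 (H.4) and §2.1]
[cite: NeukirchSchmidtWingberg2008, I §4 (1.4.2)] -/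
theorem cohomologyMap_localCup_eq_localTatePairing [Finite M] (v : Place K) (x : galoisCohomology (ρ.toLocal v) 1)
    (y : galoisCohomology ((cd.twist ρ).toLocal v) 1) :
    cohomologyMap (D.expLamLocalHom lam hlam exp hexp v) 2 (D.localCup v x y) =
      localTatePairing ρ (p ^ k) v x
        (galoisCohomology.map (Literature.NumberTheory.EllipticCurves.DiscreteGaloisModule.localMap
          (D.toTateDual lam hlam exp hexp) v) 1 y) := by
  -- step 1: push the value module along `exp ∘ λ`
  have h1 := ContPairing.cupProduct_map (D.ePairingLocal v) (D.muPairingLocal lam hlam exp hexp v) (𝟙 _) (𝟙 _)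
    (D.expLamLocalHom lam hlam exp hexp v) (fun _ _ => rfl) x y
  have hx : cohomologyMap (𝟙 (ρ.toLocal v).toTopRep) 1 x = x := by
    rw [show cohomologyMap (𝟙 (ρ.toLocal v).toTopRep) 1 = 𝟙 _ from ContinuousCohomology.map_id _ _]; rfl
  have hy : cohomologyMap (𝟙 ((cd.twist ρ).toLocal v).toTopRep) 1 y = y := by
    rw [show cohomologyMap (𝟙 ((cd.twist ρ).toLocal v).toTopRep) 1 = 𝟙 _ from ContinuousCohomology.map_id _ _]; rfl
  rw [hx, hy] at h1
  -- step 2: adjoint naturality against the evaluation pairing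
  have h2 := ContPairing.cupProduct_adjoint (tateDualPairingLocal ρ (p ^ k) v) (D.muPairingLocal lam hlam exp hexp v)
    (𝟙 _)
    (TopRep.ofHom ⟨(Literature.NumberTheory.EllipticCurves.DiscreteGaloisModule.localMap
        (D.toTateDual lam hlam exp hexp) v).toContinuousLinearMap,
      (Literature.NumberTheory.EllipticCurves.DiscreteGaloisModule.localMap
        (D.toTateDual lam hlam exp hexp) v).isIntertwining'⟩)
    (fun _ _ => rfl) x y
  rw [hx] at h2
  change cohomologyMap (D.expLamLocalHom lam hlam exp hexp v) 2 ((D.ePairingLocal v).cupProduct x y) = _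
  rw [h1, h2]
  rfl

/-- **Isotropy transfers**: `x ∪_e y = 0` in `H²(K_v, R(1))` implies `⟨x, Θ_* y⟩_{Tate} = 0` in `H²(K_v, μ_{p^k})`.
[cite: Howard2004HeegnerKolyvagin, §1.3 (H.4)] -/
theorem localTatePairing_eq_zero_of_localCup_eq_zero [Finite M] (v : Place K)
    {x : galoisCohomology (ρ.toLocal v) 1} {y : galoisCohomology ((cd.twist ρ).toLocal v) 1}
    (h : D.localCup v x y = 0) :
    localTatePairing ρ (p ^ k) v x
        (galoisCohomology.map (Literature.NumberTheory.EllipticCurves.DiscreteGaloisModule.localMap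
          (D.toTateDual lam hlam exp hexp) v) 1 y) = 0 := by
  have h' := D.cohomologyMap_localCup_eq_localTatePairing lam hlam exp hexp v x y
  rw [h] at h'
  rw [← h']
  exact map_zero _

/-- Consequently every `localTatePairing`-annihilator statement against `Θ_*(G)` gives the corresponding inclusion for
`localCup`: if `x` pairs to zero with all of `G` under `∪_e`, it pairs to zero with all of `Θ_*(G)` under local Tate
duality. [cite: Howard2004HeegnerKolyvagin, §1.3 (H.4)] -/
theorem forall_localTatePairing_eq_zero_of_forall_localCup_eq_zero [Finite M] (v : Place K)
    (G : AddSubgroup (galoisCohomology ((cd.twist ρ).toLocal v) 1)) (x : galoisCohomology (ρ.toLocal v) 1)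
    (h : ∀ y ∈ G, D.localCup v x y = 0) :
    ∀ z ∈ G.map (galoisCohomology.map (Literature.NumberTheory.EllipticCurves.DiscreteGaloisModule.localMap
          (D.toTateDual lam hlam exp hexp) v) 1),
      localTatePairing ρ (p ^ k) v x z = 0 := by
  rintro z ⟨y, hy, rfl⟩
  exact D.localTatePairing_eq_zero_of_localCup_eq_zero lam hlam exp hexp v (h y hy)

end DualityDatum

end Literature.NumberTheory.GaloisCohomology.Howard2004
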